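import Mathlib
import Literature.AlgebraicGeometry.Resolution.CobordantGame
import Literature.AlgebraicGeometry.Resolution.CobordantArcLemma
import Summits.ResolutionOfSingularities.ResolutionOfSingularities.Theorems.WeightedInvariantLocalWeightedDropGradedSliceTwistedRecentre

/-!
# `WeightedInvariant.LocalWeightedDrop`: the wild slice clause — THE EXIT TEST AT A NON-SATURATED SUCCESSOR POINT
# (which coefficient decides whether the downstairs successor is singular)

Route `ResolutionOfSingularities/WeightedInvariant`, crux `LocalWeightedDrop` (stmt-ResolutionOfSingularities-8899).
[OURS · L1 W4.3] — res-type-060 (gen 10), WILD LIBRARY file 21 (optional object (T-contact) of the AVAILABLE line 13:58:39Z; memo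
L/res-type-060-w43/WILD-SLICE-CLAUSE.md §9-bis).  Nothing here is a statement of the manuscript under review on ladder RESOLUTION; not a
verdict on card A.  AI proof, weaker than expert review.

File 19 (`…GradedSliceTwistedRecentre`, p534599) proved the saturation-free successor correspondence: a singular successor `G₁` of a twisted
cylinder sits over a singular successor `h₁` of the slice, with the TRANSLATION-TYPE relation on the Frobenius cover
  **TT(G₁, h₁):  `G₁(…, y^q) = (1+y)^{a'} · h₁(𝒪)`**,  `𝒪 = orbitSubst τ W c'` (res-type-099, p529199).
Conversely one wants to know WHEN the successor over a singular `h₁` is itself singular (exit (ii) of memo §9(d): the obstruction to the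
same-rank transfer) or smooth (exit (i): nothing to transfer).  This file reads it off TT:
* `constantCoeff_eq_of_transType`, `coeff_single_castSucc_eq_of_transType` — the constant and the OLD linear coefficients of `G₁` are those
  of `h₁` (so they vanish with `h₁`'s);
* `coeff_single_last_eq_of_transType` — the IDLE linear coefficient of `G₁` is the `y^q`-coefficient of `(1+y)^{a'} · h₁(𝒪)` — the
  «TWIST-CONTACT FORM» of `h₁` at the point;
* `singular_iff_of_transType` — hence **`G₁ ∈ 𝔪²` iff `h₁ ∈ 𝔪²` and the twist-contact form vanishes.**
At `q = 2` and `h₁ ∈ 𝔪²` the form is the tangent quadric of `h₁` evaluated on the twist velocity `(c'ⱼ·τⱼ)ⱼ` (hand computation, memo §9-bis;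
e.g. the umbrella: `h₁ = Z'²`, velocity `1`, form `1 ≠ 0`, successor smooth).  Under pointwise saturation (file 20) the form is irrelevant:
the re-centred successor is a twisted cylinder and the transfer goes through regardless.
-/

set_option linter.dupNamespace false -- mandated namespace of this single-conjunct summit
set_option autoImplicit false

namespace Summit.ResolutionOfSingularities.ResolutionOfSingularities.Theorems

namespace GradedGame

open MvPowerSeries
open Literature.AlgebraicGeometry.Resolution

variable {k : Type} [Field k]

section TwistContact

variable {n : ℕ} (q : ℕ) (hq : 0 < q) (τ : Fin (n + 1) → ℕ) (W : Fin (n + 1) → ℕ) (c' : Fin (n + 1) → k) (a' : ℕ)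
  (h₁ : MvPowerSeries (Fin (n + 1 + 1)) k) (G₁ : MvPowerSeries (Fin (n + 1 + 1 + 1)) k)
  (hTT : subst (frobFamily (k := k) (n + 1) q) G₁ =
    (1 + X (Fin.last (n + 1 + 1))) ^ a' * subst (orbitSubst (k := k) τ W c') h₁)

include hq hTT

/-- Under TT the constant coefficient of the successor is that of the slice's successor. [OURS · L1 W4.3] -/
theorem constantCoeff_eq_of_transType : constantCoeff G₁ = constantCoeff h₁ := by
  have h0 := constantCoeff_subst_frobFamily (n + 1) q hq G₁
  rw [hTT, map_mul, map_pow, map_add, map_one, constantCoeff_X, add_zero, one_pow, one_mul,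
    constantCoeff_subst_of_constantCoeff_zero _ (constantCoeff_orbitSubst τ W c')] at h0
  exact h0.symm

/-- Under TT the OLD linear coefficients of the successor are those of the slice's successor. [OURS · L1 W4.3] -/
theorem coeff_single_castSucc_eq_of_transType (J : Fin (n + 1 + 1)) :
    coeff (Finsupp.single (Fin.castSucc J) 1) G₁ = coeff (Finsupp.single J 1) h₁ := by
  have hj := coeff_single_subst_frobFamily_castSucc (n + 1) q hq G₁ J
  rw [hTT, coeff_one_add_X_pow_mul_of_last_eq_zero _ _ _ (by rw [Finsupp.single_apply, if_neg (Fin.castSucc_lt_last J).ne]),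
    Literature.AlgebraicGeometry.Resolution.CobordantArc.coeff_degree_one_subst _ (constantCoeff_orbitSubst τ W c') h₁ _
      (Finsupp.degree_single _ _),
    Finset.sum_eq_single J] at hj
  · rw [coeff_single_castSucc_orbitSubst, if_pos rfl, mul_one] at hj
    exact hj.symm
  · intro J' _ hJ'
    rw [coeff_single_castSucc_orbitSubst, if_neg hJ', mul_zero]
  · intro h; exact absurd (Finset.mem_univ _) h

/-- **THE TWIST-CONTACT FORM**: under TT the IDLE linear coefficient of the successor is the `y^q`-coefficient of
`(1+y)^{a'} · h₁(𝒪)`. [OURS · L1 W4.3] -/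
theorem coeff_single_last_eq_of_transType :
    coeff (Finsupp.single (Fin.last (n + 1 + 1)) 1) G₁ =
      coeff (Finsupp.single (Fin.last (n + 1 + 1)) q)
        ((1 + X (Fin.last (n + 1 + 1))) ^ a' * subst (orbitSubst (k := k) τ W c') h₁) := by
  have hlin : (Finsupp.single (Fin.last (n + 1 + 1)) q : Fin (n + 1 + 1 + 1) →₀ ℕ) =
      linExp (frobExp (n + 1 + 1) q) (Finsupp.single (Fin.last (n + 1 + 1)) 1) := by
    ext v
    refine Fin.lastCases ?_ (fun j => ?_) v
    · rw [linExp_frobExp_last, Finsupp.single_eq_same, Finsupp.single_eq_same, one_mul]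
    · rw [linExp_frobExp_castSucc, Finsupp.single_apply, Finsupp.single_apply,
        if_neg (Fin.castSucc_lt_last j).ne', if_neg (Fin.castSucc_lt_last j).ne']
  have h := coeff_linExp_subst_frobFamily (n + 1) q hq G₁ (Finsupp.single (Fin.last (n + 1 + 1)) 1)
  rw [← hlin, hTT] at h
  exact h.symm

/-- **THE EXIT TEST**: under TT the downstairs successor is SINGULAR (`∈ 𝔪²`) iff the slice's successor is singular AND the twist-contact
form vanishes.  (Exit (i) of memo §9(d) = non-vanishing form: the downstairs successor is smooth and the same-rank transfer has nothing to do at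
that point; exit (ii) = vanishing form: translation-type singular successor, the located obstruction.) [OURS · L1 W4.3] -/
theorem singular_iff_of_transType :
    (constantCoeff G₁ = 0 ∧ ∀ j, coeff (Finsupp.single j 1) G₁ = 0) ↔
      ((constantCoeff h₁ = 0 ∧ ∀ J, coeff (Finsupp.single J 1) h₁ = 0) ∧
        coeff (Finsupp.single (Fin.last (n + 1 + 1)) q)
          ((1 + X (Fin.last (n + 1 + 1))) ^ a' * subst (orbitSubst (k := k) τ W c') h₁) = 0) := by
  constructor
  · rintro ⟨h0, hlin⟩
    refine ⟨⟨?_, fun J => ?_⟩, ?_⟩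
    · rw [← constantCoeff_eq_of_transType q hq τ W c' a' h₁ G₁ hTT]; exact h0
    · rw [← coeff_single_castSucc_eq_of_transType q hq τ W c' a' h₁ G₁ hTT J]; exact hlin _
    · rw [← coeff_single_last_eq_of_transType q hq τ W c' a' h₁ G₁ hTT]; exact hlin _
  · rintro ⟨⟨h0, hlin⟩, hform⟩
    refine ⟨by rw [constantCoeff_eq_of_transType q hq τ W c' a' h₁ G₁ hTT]; exact h0, fun j => ?_⟩
    refine Fin.lastCases ?_ (fun J => ?_) j
    · rw [coeff_single_last_eq_of_transType q hq τ W c' a' h₁ G₁ hTT]; exact hform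
    · rw [coeff_single_castSucc_eq_of_transType q hq τ W c' a' h₁ G₁ hTT J]; exact hlin J

end TwistContact

end GradedGame

end Summit.ResolutionOfSingularities.ResolutionOfSingularities.Theorems
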